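import Summits.Ventures.HodgeRepro2.T5AbelianCharacterDetermines
import Summits.Ventures.HodgeRepro2.T5IntertwinerFormula
import Summits.Ventures.HodgeRepro2.T5WeightSpaceHom

/-!
# Summary: finite-dimensional representation theory of compact groups on the tree (gen 14)

One entry point restating the headline results of `T5AbelianWeightIndependence`,
`T5AbelianCharacterDetermines`, `T5CharacterDeterminesGeneral`, `T5IntertwinerDimension` and
`T5IntertwinerFormula` and `T5WeightSpaceHom`, each proved by reference.  Throughout, `G` is a
compact Hausdorff topological group with its Borel σ-algebra, `haarProb G` its normalised Haar
measure, representations are continuous homomorphisms `G →* V →L[ℂ] V` on finite-dimensional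
complex inner-product spaces, `character π g = tr (π g)`, and `Hom_G(σ, π)` is Mathlib's
`Representation.IntertwiningMap (toRep σ) (toRep π)`.

1. `weight_decomposition` — for a commutative `K`: `V = ⨁_χ V_χ` (internal direct sum over all
   characters) and `χ_π = Σ_χ dim V_χ · χ`.
2. `character_determines_abelian` / `character_determines` — equal characters ⟺ equivalent
   representations (compact abelian, then every compact group).
3. `finrank_hom` — `dim Hom_G(π, π') = ∫ χ_π' · conj χ_π`; `finrank_hom_irreducible` — for an
   irreducible `σ` this is the multiplicity of `σ` in any irreducible decomposition.
4. `irreducible_iff` — a non-zero `π` is irreducible ⟺ `∫ |χ_π|² = 1`.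
5. `weightSpace_finrank` — `dim V_χ = dim Hom_K(charRep χ, π)`.

Blind lane: Mathlib + own prefix only; no sorry; axioms ⊆ {propext, Classical.choice, Quot.sound}.
-/

namespace Summit.Ventures.HodgeRepro2.T5CompactGroupSummary

open T5SchurOrthogonality T5CompleteReducibility T5RestrictionRep T5SchurMathlib T5WeightSpaces
  MeasureTheory

variable {G : Type*} [Group G] [TopologicalSpace G] [IsTopologicalGroup G] [MeasurableSpace G]
  [BorelSpace G] [CompactSpace G] [T2Space G]
variable {V : Type*} [NormedAddCommGroup V] [InnerProductSpace ℂ V] [FiniteDimensional ℂ V]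
  {V' : Type*} [NormedAddCommGroup V'] [InnerProductSpace ℂ V'] [FiniteDimensional ℂ V']

/-- **1. The weight decomposition** of a continuous representation of a compact abelian group:
`V = ⨁_χ V_χ` over all characters, and `χ_π(k) = Σ_{χ ∈ weights π} dim V_χ · χ(k)`. -/
theorem weight_decomposition [IsMulCommutative G] [DecidableEq (G →* ℂˣ)] (π : G →* V →L[ℂ] V)
    (hπ : Continuous π) :
    DirectSum.IsInternal (fun χ : G →* ℂˣ => weightSpace π χ) ∧
      ∀ k, character π k = ∑ χ ∈ T5AbelianWeightIndependence.weights π,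
        (Module.finrank ℂ (weightSpace π χ) : ℂ) * ((χ k : ℂˣ) : ℂ) :=
  ⟨T5AbelianWeightIndependence.isInternal_weightSpace π hπ,
    T5AbelianWeightIndependence.character_eq_sum_finrank_mul π hπ⟩

/-- **2a. The character determines the representation — compact abelian groups.** -/
theorem character_determines_abelian [IsMulCommutative G] (π : G →* V →L[ℂ] V)
    (π' : G →* V' →L[ℂ] V') (hπ : Continuous π) (hπ' : Continuous π') :
    (∃ e : V ≃ₗ[ℂ] V', ∀ (g : G) (v : V), e (π g v) = π' g (e v)) ↔ character π = character π' :=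
  T5AbelianCharacterDetermines.exists_linearEquiv_iff_character_eq π π' hπ hπ'

/-- **2b. The character determines the representation — every compact Hausdorff group.** -/
theorem character_determines (π : G →* V →L[ℂ] V) (π' : G →* V' →L[ℂ] V') (hπ : Continuous π)
    (hπ' : Continuous π') :
    Nonempty ((toRep π).Equiv (toRep π')) ↔ character π = character π' :=
  T5CharacterDeterminesGeneral.nonempty_equiv_iff_character_eq π π' hπ hπ'

/-- **3a. `dim Hom_G(π, π') = ∫ χ_π' · conj χ_π`.** -/
theorem finrank_hom (π : G →* V →L[ℂ] V) (π' : G →* V' →L[ℂ] V') (hπ : Continuous π)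
    (hπ' : Continuous π') :
    (Module.finrank ℂ ((toRep π).IntertwiningMap (toRep π')) : ℂ) =
      ∫ g, character π' g * (starRingEnd ℂ) (character π g) ∂haarProb G :=
  T5IntertwinerFormula.finrank_intertwiningMap_eq_integral' π π' hπ hπ'

open scoped Classical in
/-- **3b. The multiplicity**: for an irreducible `σ`, `dim Hom_G(σ, π)` is the number of summands
of any irreducible internal decomposition of `V` equivalent to `σ`. -/
theorem finrank_hom_irreducible {W₀ : Type*} [NormedAddCommGroup W₀] [InnerProductSpace ℂ W₀]
    [FiniteDimensional ℂ W₀] [Nontrivial W₀] (σ : G →* W₀ →L[ℂ] W₀) (hσc : Continuous σ)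
    (hσi : IsIrreducible σ) (π : G →* V →L[ℂ] V) (hπ : Continuous π)
    (S : Finset (Submodule ℂ V)) (hS : ∀ W ∈ S, IsIrreducibleSubspace π W)
    (hint : DirectSum.IsInternal fun W : S => (W : Submodule ℂ V)) :
    Module.finrank ℂ ((toRep σ).IntertwiningMap (toRep π)) =
      ∑ W : S, if Nonempty ((toRep σ).Equiv (toRep (restrictRep π W (hS W W.2).2.1))) then 1
        else 0 :=
  T5IntertwinerDimension.finrank_intertwiningMap_eq_sum σ hσc hσi π hπ S hS hint

/-- **4. The irreducibility criterion**: a non-zero `π` is irreducible ⟺ `∫ |χ_π|² = 1`. -/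
theorem irreducible_iff [Nontrivial V] (π : G →* V →L[ℂ] V) (hπ : Continuous π) :
    IsIrreducible π ↔
      ∫ g, character π g * (starRingEnd ℂ) (character π g) ∂haarProb G = 1 :=
  T5IntertwinerFormula.isIrreducible_iff_integral_norm_sq_eq_one π hπ

omit [TopologicalSpace G] [IsTopologicalGroup G] [MeasurableSpace G] [BorelSpace G] [CompactSpace G]
  [T2Space G] [FiniteDimensional ℂ V] in
/-- **5. Weight spaces are intertwiner spaces**: `dim V_χ = dim Hom_G(charRep χ, π)`. -/
theorem weightSpace_finrank (π : G →* V →L[ℂ] V) (χ : G →* ℂˣ) :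
    Module.finrank ℂ (weightSpace π χ) =
      Module.finrank ℂ ((toRep (charRep χ)).IntertwiningMap (toRep π)) :=
  T5WeightSpaceHom.finrank_weightSpace_eq_finrank_intertwiningMap π χ

end Summit.Ventures.HodgeRepro2.T5CompactGroupSummary
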